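import Mathlib.Data.Real.Basic
import Mathlib.Tactic.Linarith
import Mathlib.Tactic.Ring
import Mathlib.Tactic.FieldSimp
import Mathlib.Tactic.Positivity
import Mathlib.Tactic.LinearCombination
import HarnessLib
import Summits.CriticalPhenomena.PercolationContinuityZ3.Theorems.PercNearOneGluingNoHeavyQuantGatedSliceMixLawQKIneqLHDefs

/-!
# QUANT lane R8, (III) blob case — cell QK, class LM (`qk_Ib_lh`): Positivstellensatz certificates, part C

The y-free endpoint fact `FD ≥ 0` of `…QKIneqLHDefs` (slope at `a₀` of `T(S/k₂)` in the shift `a`).  The certificate was found in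
dehomogenised variables (`k₂ − k₁ = 1`, `u = (1−z)λ` eliminated through `u(k₂−k₁) = Yk₂ − (1−z)k₁`; kit job j197939, products of ≤ 6 hypotheses) and is re-homogenised here: all factors are λ-free, and `(k₂−k₁)^r·FD` is rewritten λ-free using `hud`.

builds on p205010 (kernel theorem, internal audit signed; external expert review pending)

Support file (`--supports stmt-CriticalPhenomena-4575`), QUANT lane seat prim-quant-arm-1 (gen 41), rung R8 of `run/shared/lean/prim/quant/LADDER.md`.
HONEST STATUS: `GatedSliceMixLaw'` (regime R), CW, `GateMove`, `GatedConvEmptyFree`, `SingleGateConvClosed`, `TreeDEC`, `FarTreeRow` OPEN; RATE unchanged.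
[this work].  Nothing here is cited as a published result.
-/

namespace Summit.CriticalPhenomena.PercolationContinuityZ3.Theorems

namespace Quant

namespace LawDec

set_option linter.unusedVariables false in
set_option maxRecDepth 16384 in
set_option maxHeartbeats 4000000 in
/-- endpoint fact (LP certificate G_FD_d6: dehomogenised form, re-homogenised with `u·(k₂−k₁) = Y k₂ − (1−z)k₁`). [this work] -/
theorem qkFD_nonneg (Y z g lam S k₁ k₂ : ℝ) (hz0 : 0 ≤ z) (hz1 : z < 1) (hg0 : 0 ≤ g) (hg1 : g ≤ 1) (hlam0 : 0 ≤ lam) (hlam1 : lam ≤ 1)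
    (hk₁ : 0 ≤ k₁) (hk : k₁ + 1 ≤ k₂) (hmean : (1 - z) * (k₁ + (k₂ - k₁) * lam) = S) (hD0 : 0 ≤ S - 2 * k₁)
    (hY : Y * k₂ = S) (hY0 : 0 ≤ Y) (hY1 : 0 ≤ 1 - Y) (htaY : Y ≤ (1 - z) * g) (hR2 : 0 ≤ 2 * k₂ - S - (1 - z) * g * (k₂ - k₁))
    (hpos : 0 ≤ Y * (1 - (1 - z) * (1 - lam) * g - (1 - z) * lam * (1 - g)) - (1 - z) * lam * g) :
    0 ≤ qkFD Y z g lam S k₁ k₂ := by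
  have h1z : 0 < 1 - z := by linarith
  have hd0 : 0 < k₂ - k₁ := by linarith
  have hK0 : 0 ≤ k₂ := by linarith
  have hmg1 : (1 - z) * g ≤ (1 - z) * 1 := mul_le_mul_of_nonneg_left hg1 h1z.le
  have hmY : 0 ≤ (1 - z) - Y := by linarith
  have hud : (1 - z) * lam * (k₂ - k₁) = Y * k₂ - (1 - z) * k₁ := by linear_combination hmean - hY
  have hUD : 0 ≤ Y * k₂ - (1 - z) * k₁ := by rw [← hud]; exact mul_nonneg (mul_nonneg h1z.le hlam0) hd0.le
  have hE0 : 0 ≤ 1 - (1 - z) * (1 - lam) * g - (1 - z) * lam * (1 - g) := by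
    have h1 : (1 - z) * (1 - lam) * g ≤ (1 - lam) * 1 := by
      have := mul_le_mul (mul_le_of_le_one_left (sub_nonneg.2 hlam1) (by linarith : 1 - z ≤ 1)) hg1 hg0 (sub_nonneg.2 hlam1)
      linarith
    have h2 : (1 - z) * lam * (1 - g) ≤ lam * 1 := by
      have := mul_le_mul (mul_le_of_le_one_left hlam0 (by linarith : 1 - z ≤ 1)) (by linarith : 1 - g ≤ 1) (sub_nonneg.2 hg1) hlam0
      linarith
    linarith
  have hEd : 0 ≤ (k₂ - k₁) - g * (((1 - z) - Y) * k₂) - (Y * k₂ - (1 - z) * k₁) * (1 - g) := by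
    have e1 : (k₂ - k₁) - g * (((1 - z) - Y) * k₂) - (Y * k₂ - (1 - z) * k₁) * (1 - g) = (1 - (1 - z) * (1 - lam) * g - (1 - z) * lam * (1 - g)) * (k₂ - k₁) := by
      linear_combination (1 - 2 * g) * hud
    rw [e1]; exact mul_nonneg hE0 hd0.le
  have hXd : 0 ≤ Y * ((k₂ - k₁) - g * (((1 - z) - Y) * k₂) - (Y * k₂ - (1 - z) * k₁) * (1 - g)) - (Y * k₂ - (1 - z) * k₁) * g := by
    have e2 : Y * ((k₂ - k₁) - g * (((1 - z) - Y) * k₂) - (Y * k₂ - (1 - z) * k₁) * (1 - g)) - (Y * k₂ - (1 - z) * k₁) * g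
        = (Y * (1 - (1 - z) * (1 - lam) * g - (1 - z) * lam * (1 - g)) - (1 - z) * lam * g) * (k₂ - k₁) := by
      linear_combination (Y * (1 - 2 * g) + g) * hud
    rw [e2]; exact mul_nonneg hpos hd0.le
  have h2KS' : 0 ≤ 2 * k₂ - S := by nlinarith [hR2, mul_nonneg (mul_nonneg h1z.le hg0) hd0.le]
  subst hY
  have h2KS : 0 ≤ 2 * k₂ - Y * k₂ := by linarith
  have s_h1g : 0 ≤ (1 - g) := (sub_nonneg.2 hg1)
  have s_h1m : 0 ≤ z := hz0
  have s_h1y : 0 ≤ (1 - Y) := hY1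
  have s_hB : 0 ≤ (g * (((1 - z) - Y) * k₂)) := (mul_nonneg hg0 (mul_nonneg hmY hK0))
  have s_hC : 0 ≤ ((Y * k₂ - (1 - z) * k₁) * (1 - g)) := (mul_nonneg hUD (sub_nonneg.2 hg1))
  have s_hD : 0 ≤ ((Y * k₂ - (1 - z) * k₁) * g) := (mul_nonneg hUD hg0)
  have s_hD0 : 0 ≤ (Y * k₂ - 2 * k₁) := hD0
  have s_hR2 : 0 ≤ (2 * k₂ - Y * k₂ - (1 - z) * g * (k₂ - k₁)) := hR2
  have s_hd : 0 ≤ (k₂ - k₁) := hd0.le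
  have s_hg : 0 ≤ g := hg0
  have s_hk : 0 ≤ k₁ := hk₁
  have s_hm : 0 ≤ (1 - z) := h1z.le
  have s_hmu : 0 ≤ (((1 - z) - Y) * k₂) := (mul_nonneg hmY hK0)
  have s_hpos : 0 ≤ (Y * ((k₂ - k₁) - g * (((1 - z) - Y) * k₂) - (Y * k₂ - (1 - z) * k₁) * (1 - g)) - (Y * k₂ - (1 - z) * k₁) * g) := hXd
  have s_hu : 0 ≤ (Y * k₂ - (1 - z) * k₁) := hUD
  have s_hy : 0 ≤ Y := hY0
  have s_thr : 0 ≤ ((1 - z) * g - Y) := (sub_nonneg.2 htaY)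
  have conv : (k₂ - k₁) ^ 1 * qkFD Y z g lam (Y * k₂) k₁ k₂ = (-8:ℝ) * g ^ 2 * k₁ * k₂ + (4:ℝ) * g ^ 2 * k₁ ^ 2 + (2:ℝ) * g ^ 3 * k₁ * k₂ + (-2:ℝ) * g ^ 3 * k₁ ^ 2 + (16:ℝ) * z * g ^ 2 * k₁ * k₂ + (-8:ℝ) * z * g ^ 2 * k₁ ^ 2 + (-6:ℝ) * z * g ^ 3 * k₁ * k₂ + (6:ℝ) * z * g ^ 3 * k₁ ^ 2 + (-8:ℝ) * z ^ 2 * g ^ 2 * k₁ * k₂ + (4:ℝ) * z ^ 2 * g ^ 2 * k₁ ^ 2 + (6:ℝ) * z ^ 2 * g ^ 3 * k₁ * k₂ + (-6:ℝ) * z ^ 2 * g ^ 3 * k₁ ^ 2 + (-2:ℝ) * z ^ 3 * g ^ 3 * k₁ * k₂ + (2:ℝ) * z ^ 3 * g ^ 3 * k₁ ^ 2 + (6:ℝ) * Y * g * k₁ * k₂ + (8:ℝ) * Y * g ^ 2 * k₂ ^ 2 + (10:ℝ) * Y * g ^ 2 * k₁ * k₂ + (-6:ℝ) * Y * g ^ 2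 * k₁ ^ 2 + (-2:ℝ) * Y * g ^ 3 * k₂ ^ 2 + (2:ℝ) * Y * g ^ 3 * k₁ ^ 2 + (-4:ℝ) * Y * z * g * k₁ ^ 2 + (-8:ℝ) * Y * z * g ^ 2 * k₂ ^ 2 + (-24:ℝ) * Y * z * g ^ 2 * k₁ * k₂ + (12:ℝ) * Y * z * g ^ 2 * k₁ ^ 2 + (4:ℝ) * Y * z * g ^ 3 * k₂ ^ 2 + (2:ℝ) * Y * z * g ^ 3 * k₁ * k₂ + (-6:ℝ) * Y * z * g ^ 3 * k₁ ^ 2 + (-6:ℝ) * Y * z ^ 2 * g * k₁ * k₂ + (4:ℝ) * Y * z ^ 2 * g * k₁ ^ 2 + (14:ℝ) * Y * z ^ 2 * g ^ 2 * k₁ * k₂ + (-6:ℝ) * Y * z ^ 2 * g ^ 2 * k₁ ^ 2 + (-2:ℝ) * Y * z ^ 2 * g ^ 3 * k₂ ^ 2 + (-4:ℝ) * Y * z ^ 2 * g ^ 3 * k₁ * k₂ + (6:ℝ) * Y * z ^ 2 * g ^ 3 * k₁ ^ 2 + (2:ℝ) * Y * z ^ 3 * g ^ 3 * k₁ * k₂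 + (-2:ℝ) * Y * z ^ 3 * g ^ 3 * k₁ ^ 2 + (4:ℝ) * Y ^ 2 * k₁ * k₂ + (-4:ℝ) * Y ^ 2 * g * k₂ ^ 2 + (-18:ℝ) * Y ^ 2 * g * k₁ * k₂ + (3:ℝ) * Y ^ 2 * g * k₁ ^ 2 + (-14:ℝ) * Y ^ 2 * g ^ 2 * k₂ ^ 2 + (1:ℝ) * Y ^ 2 * g ^ 2 * k₁ * k₂ + (2:ℝ) * Y ^ 2 * g ^ 3 * k₂ ^ 2 + (-1:ℝ) * Y ^ 2 * g ^ 3 * k₁ * k₂ + (-1:ℝ) * Y ^ 2 * g ^ 3 * k₁ ^ 2 + (-4:ℝ) * Y ^ 2 * z * k₁ * k₂ + (-4:ℝ) * Y ^ 2 * z * g * k₂ ^ 2 + (14:ℝ) * Y ^ 2 * z * g * k₁ * k₂ + (-2:ℝ) * Y ^ 2 * z * g * k₁ ^ 2 + (14:ℝ) * Y ^ 2 * z * g ^ 2 * k₂ ^ 2 + (5:ℝ) * Y ^ 2 * z * g ^ 2 * k₁ * k₂ + (-1:ℝ) * Y ^ 2 * z * g ^ 2 * k₁ ^ 2 + (-4:ℝ)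 * Y ^ 2 * z * g ^ 3 * k₂ ^ 2 + (1:ℝ) * Y ^ 2 * z * g ^ 3 * k₁ * k₂ + (3:ℝ) * Y ^ 2 * z * g ^ 3 * k₁ ^ 2 + (4:ℝ) * Y ^ 2 * z ^ 2 * g * k₁ * k₂ + (-1:ℝ) * Y ^ 2 * z ^ 2 * g * k₁ ^ 2 + (-7:ℝ) * Y ^ 2 * z ^ 2 * g ^ 2 * k₁ * k₂ + (2:ℝ) * Y ^ 2 * z ^ 2 * g ^ 2 * k₁ ^ 2 + (2:ℝ) * Y ^ 2 * z ^ 2 * g ^ 3 * k₂ ^ 2 + (1:ℝ) * Y ^ 2 * z ^ 2 * g ^ 3 * k₁ * k₂ + (-3:ℝ) * Y ^ 2 * z ^ 2 * g ^ 3 * k₁ ^ 2 + (1:ℝ) * Y ^ 2 * z ^ 3 * g ^ 2 * k₁ * k₂ + (-1:ℝ) * Y ^ 2 * z ^ 3 * g ^ 2 * k₁ ^ 2 + (-1:ℝ) * Y ^ 2 * z ^ 3 * g ^ 3 * k₁ * k₂ + (1:ℝ) * Y ^ 2 * z ^ 3 * g ^ 3 * k₁ ^ 2 + (-4:ℝ)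 * Y ^ 3 * k₂ ^ 2 + (-2:ℝ) * Y ^ 3 * k₁ * k₂ + (14:ℝ) * Y ^ 3 * g * k₂ ^ 2 + (4:ℝ) * Y ^ 3 * g * k₁ * k₂ + (5:ℝ) * Y ^ 3 * g ^ 2 * k₂ ^ 2 + (1:ℝ) * Y ^ 3 * g ^ 2 * k₁ * k₂ + (-1:ℝ) * Y ^ 3 * g ^ 3 * k₂ ^ 2 + (1:ℝ) * Y ^ 3 * g ^ 3 * k₁ * k₂ + (2:ℝ) * Y ^ 3 * z * k₁ * k₂ + (2:ℝ) * Y ^ 3 * z * g * k₂ ^ 2 + (-3:ℝ) * Y ^ 3 * z * g * k₁ * k₂ + (-6:ℝ) * Y ^ 3 * z * g ^ 2 * k₂ ^ 2 + (-1:ℝ) * Y ^ 3 * z * g ^ 2 * k₁ * k₂ + (2:ℝ) * Y ^ 3 * z * g ^ 3 * k₂ ^ 2 + (-2:ℝ) * Y ^ 3 * z * g ^ 3 * k₁ * k₂ + (-1:ℝ) * Y ^ 3 * z ^ 2 * g * k₁ * k₂ + (1:ℝ) * Y ^ 3 * z ^ 2 * g ^ 2 * k₂ ^ 2 + (-1:ℝ)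 * Y ^ 3 * z ^ 2 * g ^ 3 * k₂ ^ 2 + (1:ℝ) * Y ^ 3 * z ^ 2 * g ^ 3 * k₁ * k₂ + (2:ℝ) * Y ^ 4 * k₂ ^ 2 + (-5:ℝ) * Y ^ 4 * g * k₂ ^ 2 + (-1:ℝ) * Y ^ 4 * g ^ 2 * k₂ ^ 2 + (-1:ℝ) * Y ^ 4 * z * g * k₂ ^ 2 + (1:ℝ) * Y ^ 4 * z * g ^ 2 * k₂ ^ 2 := by
    unfold qkFD qkTa2 qkTa1; linear_combination ((8:ℝ) * g ^ 2 * k₂ + (-4:ℝ) * g ^ 2 * k₁ + (-2:ℝ) * g ^ 3 * k₂ + (2:ℝ) * g ^ 3 * k₁ + (-8:ℝ) * z * g ^ 2 * k₂ + (4:ℝ) * z * g ^ 2 * k₁ + (4:ℝ) * z * g ^ 3 * k₂ + (-4:ℝ) * z * g ^ 3 * k₁ + (-2:ℝ) * z ^ 2 * g ^ 3 * k₂ + (2:ℝ) * z ^ 2 * g ^ 3 * k₁ + (-2:ℝ) * Y * g * k₂ + (-4:ℝ) * Y * g * k₁ + (-14:ℝ) * Y * g ^ 2 * k₂ + (6:ℝ)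 * Y * g ^ 2 * k₁ + (2:ℝ) * Y * g ^ 3 * k₂ + (-2:ℝ) * Y * g ^ 3 * k₁ + (-6:ℝ) * Y * z * g * k₂ + (4:ℝ) * Y * z * g * k₁ + (14:ℝ) * Y * z * g ^ 2 * k₂ + (-6:ℝ) * Y * z * g ^ 2 * k₁ + (-4:ℝ) * Y * z * g ^ 3 * k₂ + (4:ℝ) * Y * z * g ^ 3 * k₁ + (2:ℝ) * Y * z ^ 2 * g ^ 3 * k₂ + (-2:ℝ) * Y * z ^ 2 * g ^ 3 * k₁ + (-4:ℝ) * Y ^ 2 * k₂ + (12:ℝ) * Y ^ 2 * g * k₂ + (1:ℝ) * Y ^ 2 * g * k₁ + (5:ℝ) * Y ^ 2 * g ^ 2 * k₂ + (-1:ℝ) * Y ^ 2 * g ^ 3 * k₂ + (1:ℝ) * Y ^ 2 * g ^ 3 * k₁ + (4:ℝ) * Y ^ 2 * z * g * k₂ + (-1:ℝ) * Y ^ 2 * z * g * k₁ + (-6:ℝ) * Y ^ 2 * z * g ^ 2 * k₂ + (1:ℝ) * Y ^ 2 * z * g ^ 2 * k₁ + (2:ℝ) * Y ^ 2 * z * g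 ^ 3 * k₂ + (-2:ℝ) * Y ^ 2 * z * g ^ 3 * k₁ + (1:ℝ) * Y ^ 2 * z ^ 2 * g ^ 2 * k₂ + (-1:ℝ) * Y ^ 2 * z ^ 2 * g ^ 2 * k₁ + (-1:ℝ) * Y ^ 2 * z ^ 2 * g ^ 3 * k₂ + (1:ℝ) * Y ^ 2 * z ^ 2 * g ^ 3 * k₁ + (2:ℝ) * Y ^ 3 * k₂ + (-5:ℝ) * Y ^ 3 * g * k₂ + (-1:ℝ) * Y ^ 3 * g ^ 2 * k₂ + (-1:ℝ) * Y ^ 3 * z * g * k₂ + (1:ℝ) * Y ^ 3 * z * g ^ 2 * k₂) * hud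
  have key : (((3185:ℝ)/5756) * Y + ((2571:ℝ)/5756) * (1 - Y)) * ((-8:ℝ) * g ^ 2 * k₁ * k₂ + (4:ℝ) * g ^ 2 * k₁ ^ 2 + (2:ℝ) * g ^ 3 * k₁ * k₂ + (-2:ℝ) * g ^ 3 * k₁ ^ 2 + (16:ℝ) * z * g ^ 2 * k₁ * k₂ + (-8:ℝ) * z * g ^ 2 * k₁ ^ 2 + (-6:ℝ) * z * g ^ 3 * k₁ * k₂ + (6:ℝ) * z * g ^ 3 * k₁ ^ 2 + (-8:ℝ) * z ^ 2 * g ^ 2 * k₁ * k₂ + (4:ℝ) * z ^ 2 * g ^ 2 * k₁ ^ 2 + (6:ℝ) * z ^ 2 * g ^ 3 * k₁ * k₂ + (-6:ℝ) * z ^ 2 * g ^ 3 * k₁ ^ 2 + (-2:ℝ) * z ^ 3 * g ^ 3 * k₁ * k₂ + (2:ℝ) * z ^ 3 * g ^ 3 * k₁ ^ 2 + (6:ℝ) * Y * g * k₁ * k₂ + (8:ℝ) * Y * g ^ 2 * k₂ ^ 2 + (10:ℝ) * Y * g ^ 2 * k₁ * k₂ + (-6:ℝ) * Y * g ^ 2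 * k₁ ^ 2 + (-2:ℝ) * Y * g ^ 3 * k₂ ^ 2 + (2:ℝ) * Y * g ^ 3 * k₁ ^ 2 + (-4:ℝ) * Y * z * g * k₁ ^ 2 + (-8:ℝ) * Y * z * g ^ 2 * k₂ ^ 2 + (-24:ℝ) * Y * z * g ^ 2 * k₁ * k₂ + (12:ℝ) * Y * z * g ^ 2 * k₁ ^ 2 + (4:ℝ) * Y * z * g ^ 3 * k₂ ^ 2 + (2:ℝ) * Y * z * g ^ 3 * k₁ * k₂ + (-6:ℝ) * Y * z * g ^ 3 * k₁ ^ 2 + (-6:ℝ) * Y * z ^ 2 * g * k₁ * k₂ + (4:ℝ) * Y * z ^ 2 * g * k₁ ^ 2 + (14:ℝ) * Y * z ^ 2 * g ^ 2 * k₁ * k₂ + (-6:ℝ) * Y * z ^ 2 * g ^ 2 * k₁ ^ 2 + (-2:ℝ) * Y * z ^ 2 * g ^ 3 * k₂ ^ 2 + (-4:ℝ) * Y * z ^ 2 * g ^ 3 * k₁ * k₂ + (6:ℝ) * Y * z ^ 2 * g ^ 3 * k₁ ^ 2 + (2:ℝ) * Y * z ^ 3 * g ^ 3 * k₁ * k₂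 + (-2:ℝ) * Y * z ^ 3 * g ^ 3 * k₁ ^ 2 + (4:ℝ) * Y ^ 2 * k₁ * k₂ + (-4:ℝ) * Y ^ 2 * g * k₂ ^ 2 + (-18:ℝ) * Y ^ 2 * g * k₁ * k₂ + (3:ℝ) * Y ^ 2 * g * k₁ ^ 2 + (-14:ℝ) * Y ^ 2 * g ^ 2 * k₂ ^ 2 + (1:ℝ) * Y ^ 2 * g ^ 2 * k₁ * k₂ + (2:ℝ) * Y ^ 2 * g ^ 3 * k₂ ^ 2 + (-1:ℝ) * Y ^ 2 * g ^ 3 * k₁ * k₂ + (-1:ℝ) * Y ^ 2 * g ^ 3 * k₁ ^ 2 + (-4:ℝ) * Y ^ 2 * z * k₁ * k₂ + (-4:ℝ) * Y ^ 2 * z * g * k₂ ^ 2 + (14:ℝ) * Y ^ 2 * z * g * k₁ * k₂ + (-2:ℝ) * Y ^ 2 * z * g * k₁ ^ 2 + (14:ℝ) * Y ^ 2 * z * g ^ 2 * k₂ ^ 2 + (5:ℝ) * Y ^ 2 * z * g ^ 2 * k₁ * k₂ + (-1:ℝ) * Y ^ 2 * z * g ^ 2 * k₁ ^ 2 + (-4:ℝ)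 * Y ^ 2 * z * g ^ 3 * k₂ ^ 2 + (1:ℝ) * Y ^ 2 * z * g ^ 3 * k₁ * k₂ + (3:ℝ) * Y ^ 2 * z * g ^ 3 * k₁ ^ 2 + (4:ℝ) * Y ^ 2 * z ^ 2 * g * k₁ * k₂ + (-1:ℝ) * Y ^ 2 * z ^ 2 * g * k₁ ^ 2 + (-7:ℝ) * Y ^ 2 * z ^ 2 * g ^ 2 * k₁ * k₂ + (2:ℝ) * Y ^ 2 * z ^ 2 * g ^ 2 * k₁ ^ 2 + (2:ℝ) * Y ^ 2 * z ^ 2 * g ^ 3 * k₂ ^ 2 + (1:ℝ) * Y ^ 2 * z ^ 2 * g ^ 3 * k₁ * k₂ + (-3:ℝ) * Y ^ 2 * z ^ 2 * g ^ 3 * k₁ ^ 2 + (1:ℝ) * Y ^ 2 * z ^ 3 * g ^ 2 * k₁ * k₂ + (-1:ℝ) * Y ^ 2 * z ^ 3 * g ^ 2 * k₁ ^ 2 + (-1:ℝ) * Y ^ 2 * z ^ 3 * g ^ 3 * k₁ * k₂ + (1:ℝ) * Y ^ 2 * z ^ 3 * g ^ 3 * k₁ ^ 2 + (-4:ℝ)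 * Y ^ 3 * k₂ ^ 2 + (-2:ℝ) * Y ^ 3 * k₁ * k₂ + (14:ℝ) * Y ^ 3 * g * k₂ ^ 2 + (4:ℝ) * Y ^ 3 * g * k₁ * k₂ + (5:ℝ) * Y ^ 3 * g ^ 2 * k₂ ^ 2 + (1:ℝ) * Y ^ 3 * g ^ 2 * k₁ * k₂ + (-1:ℝ) * Y ^ 3 * g ^ 3 * k₂ ^ 2 + (1:ℝ) * Y ^ 3 * g ^ 3 * k₁ * k₂ + (2:ℝ) * Y ^ 3 * z * k₁ * k₂ + (2:ℝ) * Y ^ 3 * z * g * k₂ ^ 2 + (-3:ℝ) * Y ^ 3 * z * g * k₁ * k₂ + (-6:ℝ) * Y ^ 3 * z * g ^ 2 * k₂ ^ 2 + (-1:ℝ) * Y ^ 3 * z * g ^ 2 * k₁ * k₂ + (2:ℝ) * Y ^ 3 * z * g ^ 3 * k₂ ^ 2 + (-2:ℝ) * Y ^ 3 * z * g ^ 3 * k₁ * k₂ + (-1:ℝ) * Y ^ 3 * z ^ 2 * g * k₁ * k₂ + (1:ℝ) * Y ^ 3 * z ^ 2 * g ^ 2 * k₂ ^ 2 + (-1:ℝ)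 * Y ^ 3 * z ^ 2 * g ^ 3 * k₂ ^ 2 + (1:ℝ) * Y ^ 3 * z ^ 2 * g ^ 3 * k₁ * k₂ + (2:ℝ) * Y ^ 4 * k₂ ^ 2 + (-5:ℝ) * Y ^ 4 * g * k₂ ^ 2 + (-1:ℝ) * Y ^ 4 * g ^ 2 * k₂ ^ 2 + (-1:ℝ) * Y ^ 4 * z * g * k₂ ^ 2 + (1:ℝ) * Y ^ 4 * z * g ^ 2 * k₂ ^ 2)
      = ((115:ℝ)/5756) * ((1 - z) * z * g * (1 - g) * Y * k₁ * (k₂ - k₁)) + ((283:ℝ)/2878) * ((1 - z) * z * Y * Y * k₁ * ((1 - z) * g - Y) * (k₂ - k₁))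
      + ((307:ℝ)/1439) * ((1 - z) * g * (1 - g) * (Y * k₂ - (1 - z) * k₁) * ((1 - z) * g - Y) * (k₂ - k₁))
      + ((307:ℝ)/2878) * ((1 - z) * g * Y * Y * Y * ((Y * k₂ - (1 - z) * k₁) * (1 - g)) * (k₂ - k₁))
      + ((526:ℝ)/1439) * ((1 - z) * g * Y * Y * (Y * k₂ - 2 * k₁) * ((Y * k₂ - (1 - z) * k₁) * (1 - g)))
      + ((1343:ℝ)/5756) * ((1 - z) * g * Y * Y * ((1 - z) * g - Y) * ((Y * k₂ - (1 - z) * k₁) * (1 - g)) * (k₂ - k₁))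
      + ((701:ℝ)/5756) * ((1 - z) * g * Y * (1 - Y) * (1 - Y) * ((1 - z) * g - Y) * (k₂ - k₁) * (k₂ - k₁))
      + ((25:ℝ)/5756) * ((1 - z) * g * (1 - Y) * (1 - Y) * (Y * k₂ - 2 * k₁) * ((1 - z) * g - Y) * (k₂ - k₁)) + ((115:ℝ)/5756) * ((1 - z) * (1 - g) * (1 - g) * Y * k₁ * k₁)
      + ((24:ℝ)/1439) * ((1 - z) * Y * Y * k₁ * (2 * k₂ - Y * k₂ - (1 - z) * g * (k₂ - k₁)) * ((1 - z) * g - Y))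
      + ((283:ℝ)/2878) * ((1 - z) * Y * ((1 - z) * g - Y) * (Y * ((k₂ - k₁) - g * (((1 - z) - Y) * k₂) - (Y * k₂ - (1 - z) * k₁) * (1 - g)) - (Y * k₂ - (1 - z) * k₁) * g) * (k₂ - k₁))
      + ((283:ℝ)/2878) * (z * z * g * Y * Y * ((1 - z) * g - Y) * (k₂ - k₁) * (k₂ - k₁)) + ((331:ℝ)/2878) * (z * z * g * k₁ * ((1 - z) * g - Y) * (k₂ - k₁))
      + ((365:ℝ)/2878) * (z * g * Y * (1 - Y) * k₁ * (((1 - z) - Y) * k₂)) + ((646:ℝ)/1439) * (z * g * Y * (1 - Y) * ((1 - z) * g - Y) * (k₂ - k₁) * (k₂ - k₁))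
      + ((8:ℝ)/1439) * (z * g * Y * ((1 - z) * g - Y) * (k₂ - k₁) * (k₂ - k₁)) + ((283:ℝ)/2878) * (z * g * (1 - Y) * (Y * k₂ - (1 - z) * k₁) * ((1 - z) * g - Y) * (k₂ - k₁))
      + ((19:ℝ)/2878) * (z * g * k₁ * ((1 - z) * g - Y) * (k₂ - k₁)) + ((4297:ℝ)/5756) * (z * (1 - g) * Y * Y * (1 - Y) * k₁ * (k₂ - k₁))
      + ((125:ℝ)/2878) * (z * (1 - g) * Y * Y * k₁ * (Y * k₂ - 2 * k₁)) + ((863:ℝ)/5756) * (z * Y * Y * (1 - Y) * k₁ * (g * (((1 - z) - Y) * k₂)))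
      + ((283:ℝ)/2878) * (z * Y * Y * (1 - Y) * ((1 - z) * g - Y) * (k₂ - k₁) * (k₂ - k₁)) + ((3757:ℝ)/5756) * (z * Y * (1 - Y) * k₁ * ((1 - z) * g - Y) * (k₂ - k₁))
      + ((1103:ℝ)/1439) * (z * Y * k₁ * k₁ * ((1 - z) * g - Y)) + ((2841:ℝ)/2878) * (z * Y * k₁ * ((1 - z) * g - Y) * (k₂ - k₁))
      + ((451:ℝ)/2878) * (g * Y * (1 - Y) * (1 - Y) * ((1 - z) * g - Y) * (k₂ - k₁) * (k₂ - k₁)) + ((2233:ℝ)/5756) * (g * Y * (1 - Y) * k₁ * ((1 - z) * g - Y) * (k₂ - k₁))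
      + ((2571:ℝ)/2878) * (g * Y * k₁ * (((1 - z) - Y) * k₂) * ((1 - z) * g - Y)) + ((492:ℝ)/1439) * (g * (1 - Y) * (1 - Y) * (Y * k₂ - (1 - z) * k₁) * ((1 - z) * g - Y) * (k₂ - k₁))
      + ((175:ℝ)/2878) * (g * (1 - Y) * (1 - Y) * (Y * k₂ - 2 * k₁) * ((1 - z) * g - Y) * (k₂ - k₁))
      + ((1957:ℝ)/2878) * (g * (1 - Y) * (Y * k₂ - (1 - z) * k₁) * (2 * k₂ - Y * k₂ - (1 - z) * g * (k₂ - k₁)) * ((1 - z) * g - Y))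
      + ((3169:ℝ)/2878) * (g * (1 - Y) * (Y * k₂ - (1 - z) * k₁) * ((1 - z) * g - Y) * (k₂ - k₁)) + ((307:ℝ)/1439) * (g * (((1 - z) - Y) * k₂) * (Y * k₂ - 2 * k₁) * ((1 - z) * g - Y))
      + ((365:ℝ)/5756) * ((1 - g) * Y * Y * Y * k₁ * (Y * k₂ - 2 * k₁)) + ((2059:ℝ)/5756) * ((1 - g) * Y * Y * Y * (Y * k₂ - (1 - z) * k₁) * (Y * k₂ - 2 * k₁))
      + ((365:ℝ)/5756) * ((1 - g) * Y * Y * Y * (Y * k₂ - 2 * k₁) * (Y * k₂ - 2 * k₁)) + ((451:ℝ)/2878) * ((1 - g) * Y * Y * Y * ((1 - z) * g - Y) * (k₂ - k₁) * (k₂ - k₁))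
      + ((5027:ℝ)/5756) * ((1 - g) * Y * Y * (1 - Y) * k₁ * k₁) + ((3639:ℝ)/5756) * ((1 - g) * Y * Y * k₁ * ((1 - z) * g - Y) * (k₂ - k₁))
      + ((1375:ℝ)/2878) * ((1 - g) * Y * Y * ((1 - z) * g - Y) * (k₂ - k₁) * (k₂ - k₁)) + ((115:ℝ)/5756) * ((1 - g) * Y * k₁ * k₁ * ((1 - z) * g - Y))
      + ((2571:ℝ)/2878) * ((1 - g) * Y * (Y * k₂ - (1 - z) * k₁) * ((1 - z) * g - Y) * (k₂ - k₁)) + ((307:ℝ)/2878) * (Y * Y * Y * Y * Y * ((Y * k₂ - (1 - z) * k₁) * (1 - g)) * (k₂ - k₁))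
      + ((307:ℝ)/2878) * (Y * Y * Y * Y * (Y * k₂ - 2 * k₁) * ((Y * k₂ - (1 - z) * k₁) * (1 - g)))
      + ((307:ℝ)/1439) * (Y * Y * Y * Y * ((1 - z) * g - Y) * ((Y * k₂ - (1 - z) * k₁) * (1 - g)) * (k₂ - k₁)) + ((211:ℝ)/5756) * (Y * Y * Y * k₁ * (Y * k₂ - 2 * k₁) * ((1 - z) * g - Y))
      + ((1017:ℝ)/5756) * (Y * Y * Y * k₁ * ((1 - z) * g - Y) * ((Y * k₂ - (1 - z) * k₁) * g))
      + ((307:ℝ)/2878) * (Y * Y * Y * (Y * k₂ - 2 * k₁) * ((1 - z) * g - Y) * ((Y * k₂ - (1 - z) * k₁) * (1 - g)))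
      + ((307:ℝ)/2878) * (Y * Y * Y * ((1 - z) * g - Y) * ((1 - z) * g - Y) * ((Y * k₂ - (1 - z) * k₁) * (1 - g)) * (k₂ - k₁))
      + ((913:ℝ)/2878) * (Y * Y * (1 - Y) * (1 - Y) * k₁ * ((1 - z) * g - Y) * (k₂ - k₁)) + ((913:ℝ)/2878) * (Y * Y * (1 - Y) * (1 - Y) * ((1 - z) * g - Y) * (k₂ - k₁) * (k₂ - k₁))
      + ((365:ℝ)/5756) * (Y * Y * (1 - Y) * k₁ * k₁ * ((1 - z) * g - Y)) + ((799:ℝ)/5756) * (Y * Y * (1 - Y) * k₁ * (((1 - z) - Y) * k₂) * ((1 - z) * g - Y))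
      + ((125:ℝ)/2878) * (Y * Y * (1 - Y) * k₁ * (2 * k₂ - Y * k₂ - (1 - z) * g * (k₂ - k₁)) * ((1 - z) * g - Y))
      + ((1419:ℝ)/5756) * (Y * Y * k₁ * (((1 - z) - Y) * k₂) * ((1 - z) * g - Y))
      + ((179:ℝ)/5756) * (Y * Y * k₁ * ((1 - z) * g - Y) * (Y * ((k₂ - k₁) - g * (((1 - z) - Y) * k₂) - (Y * k₂ - (1 - z) * k₁) * (1 - g)) - (Y * k₂ - (1 - z) * k₁) * g))
      + ((315:ℝ)/2878) * (Y * Y * ((1 - z) * g - Y) * (Y * ((k₂ - k₁) - g * (((1 - z) - Y) * k₂) - (Y * k₂ - (1 - z) * k₁) * (1 - g)) - (Y * k₂ - (1 - z) * k₁) * g) * (k₂ - k₁))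
      + ((115:ℝ)/5756) * (Y * (1 - Y) * (1 - Y) * (1 - Y) * k₁ * ((Y * k₂ - (1 - z) * k₁) * (1 - g)))
      + ((3799:ℝ)/5756) * (Y * (1 - Y) * k₁ * (Y * ((k₂ - k₁) - g * (((1 - z) - Y) * k₂) - (Y * k₂ - (1 - z) * k₁) * (1 - g)) - (Y * k₂ - (1 - z) * k₁) * g))
      + ((115:ℝ)/5756) * (Y * k₁ * k₁ * ((1 - z) * g - Y))
      + ((307:ℝ)/1439) * (Y * k₁ * (Y * ((k₂ - k₁) - g * (((1 - z) - Y) * k₂) - (Y * k₂ - (1 - z) * k₁) * (1 - g)) - (Y * k₂ - (1 - z) * k₁) * g)) := by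
    ring
  have hsum : 0 ≤ (((3185:ℝ)/5756) * Y + ((2571:ℝ)/5756) * (1 - Y)) * ((-8:ℝ) * g ^ 2 * k₁ * k₂ + (4:ℝ) * g ^ 2 * k₁ ^ 2 + (2:ℝ) * g ^ 3 * k₁ * k₂ + (-2:ℝ) * g ^ 3 * k₁ ^ 2 + (16:ℝ) * z * g ^ 2 * k₁ * k₂ + (-8:ℝ) * z * g ^ 2 * k₁ ^ 2 + (-6:ℝ) * z * g ^ 3 * k₁ * k₂ + (6:ℝ) * z * g ^ 3 * k₁ ^ 2 + (-8:ℝ) * z ^ 2 * g ^ 2 * k₁ * k₂ + (4:ℝ) * z ^ 2 * g ^ 2 * k₁ ^ 2 + (6:ℝ) * z ^ 2 * g ^ 3 * k₁ * k₂ + (-6:ℝ) * z ^ 2 * g ^ 3 * k₁ ^ 2 + (-2:ℝ) * z ^ 3 * g ^ 3 * k₁ * k₂ + (2:ℝ) * z ^ 3 * g ^ 3 * k₁ ^ 2 + (6:ℝ) * Y * g * k₁ * k₂ + (8:ℝ) * Y * g ^ 2 * k₂ ^ 2 + (10:ℝ) * Y * g ^ 2 * k₁ * k₂ + (-6:ℝ)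 * Y * g ^ 2 * k₁ ^ 2 + (-2:ℝ) * Y * g ^ 3 * k₂ ^ 2 + (2:ℝ) * Y * g ^ 3 * k₁ ^ 2 + (-4:ℝ) * Y * z * g * k₁ ^ 2 + (-8:ℝ) * Y * z * g ^ 2 * k₂ ^ 2 + (-24:ℝ) * Y * z * g ^ 2 * k₁ * k₂ + (12:ℝ) * Y * z * g ^ 2 * k₁ ^ 2 + (4:ℝ) * Y * z * g ^ 3 * k₂ ^ 2 + (2:ℝ) * Y * z * g ^ 3 * k₁ * k₂ + (-6:ℝ) * Y * z * g ^ 3 * k₁ ^ 2 + (-6:ℝ) * Y * z ^ 2 * g * k₁ * k₂ + (4:ℝ) * Y * z ^ 2 * g * k₁ ^ 2 + (14:ℝ) * Y * z ^ 2 * g ^ 2 * k₁ * k₂ + (-6:ℝ) * Y * z ^ 2 * g ^ 2 * k₁ ^ 2 + (-2:ℝ) * Y * z ^ 2 * g ^ 3 * k₂ ^ 2 + (-4:ℝ) * Y * z ^ 2 * g ^ 3 * k₁ * k₂ + (6:ℝ) * Y * z ^ 2 * g ^ 3 * k₁ ^ 2 + (2:ℝ) * Y * z ^ 3 * g ^ 3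 * k₁ * k₂ + (-2:ℝ) * Y * z ^ 3 * g ^ 3 * k₁ ^ 2 + (4:ℝ) * Y ^ 2 * k₁ * k₂ + (-4:ℝ) * Y ^ 2 * g * k₂ ^ 2 + (-18:ℝ) * Y ^ 2 * g * k₁ * k₂ + (3:ℝ) * Y ^ 2 * g * k₁ ^ 2 + (-14:ℝ) * Y ^ 2 * g ^ 2 * k₂ ^ 2 + (1:ℝ) * Y ^ 2 * g ^ 2 * k₁ * k₂ + (2:ℝ) * Y ^ 2 * g ^ 3 * k₂ ^ 2 + (-1:ℝ) * Y ^ 2 * g ^ 3 * k₁ * k₂ + (-1:ℝ) * Y ^ 2 * g ^ 3 * k₁ ^ 2 + (-4:ℝ) * Y ^ 2 * z * k₁ * k₂ + (-4:ℝ) * Y ^ 2 * z * g * k₂ ^ 2 + (14:ℝ) * Y ^ 2 * z * g * k₁ * k₂ + (-2:ℝ) * Y ^ 2 * z * g * k₁ ^ 2 + (14:ℝ) * Y ^ 2 * z * g ^ 2 * k₂ ^ 2 + (5:ℝ) * Y ^ 2 * z * g ^ 2 * k₁ * k₂ + (-1:ℝ) * Y ^ 2 * z * g ^ 2 * k₁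 ^ 2 + (-4:ℝ) * Y ^ 2 * z * g ^ 3 * k₂ ^ 2 + (1:ℝ) * Y ^ 2 * z * g ^ 3 * k₁ * k₂ + (3:ℝ) * Y ^ 2 * z * g ^ 3 * k₁ ^ 2 + (4:ℝ) * Y ^ 2 * z ^ 2 * g * k₁ * k₂ + (-1:ℝ) * Y ^ 2 * z ^ 2 * g * k₁ ^ 2 + (-7:ℝ) * Y ^ 2 * z ^ 2 * g ^ 2 * k₁ * k₂ + (2:ℝ) * Y ^ 2 * z ^ 2 * g ^ 2 * k₁ ^ 2 + (2:ℝ) * Y ^ 2 * z ^ 2 * g ^ 3 * k₂ ^ 2 + (1:ℝ) * Y ^ 2 * z ^ 2 * g ^ 3 * k₁ * k₂ + (-3:ℝ) * Y ^ 2 * z ^ 2 * g ^ 3 * k₁ ^ 2 + (1:ℝ) * Y ^ 2 * z ^ 3 * g ^ 2 * k₁ * k₂ + (-1:ℝ) * Y ^ 2 * z ^ 3 * g ^ 2 * k₁ ^ 2 + (-1:ℝ) * Y ^ 2 * z ^ 3 * g ^ 3 * k₁ * k₂ + (1:ℝ) * Y ^ 2 * z ^ 3 * g ^ 3 * k₁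 ^ 2 + (-4:ℝ) * Y ^ 3 * k₂ ^ 2 + (-2:ℝ) * Y ^ 3 * k₁ * k₂ + (14:ℝ) * Y ^ 3 * g * k₂ ^ 2 + (4:ℝ) * Y ^ 3 * g * k₁ * k₂ + (5:ℝ) * Y ^ 3 * g ^ 2 * k₂ ^ 2 + (1:ℝ) * Y ^ 3 * g ^ 2 * k₁ * k₂ + (-1:ℝ) * Y ^ 3 * g ^ 3 * k₂ ^ 2 + (1:ℝ) * Y ^ 3 * g ^ 3 * k₁ * k₂ + (2:ℝ) * Y ^ 3 * z * k₁ * k₂ + (2:ℝ) * Y ^ 3 * z * g * k₂ ^ 2 + (-3:ℝ) * Y ^ 3 * z * g * k₁ * k₂ + (-6:ℝ) * Y ^ 3 * z * g ^ 2 * k₂ ^ 2 + (-1:ℝ) * Y ^ 3 * z * g ^ 2 * k₁ * k₂ + (2:ℝ) * Y ^ 3 * z * g ^ 3 * k₂ ^ 2 + (-2:ℝ) * Y ^ 3 * z * g ^ 3 * k₁ * k₂ + (-1:ℝ) * Y ^ 3 * z ^ 2 * g * k₁ * k₂ + (1:ℝ) * Y ^ 3 * z ^ 2 * g ^ 2 *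 k₂ ^ 2 + (-1:ℝ) * Y ^ 3 * z ^ 2 * g ^ 3 * k₂ ^ 2 + (1:ℝ) * Y ^ 3 * z ^ 2 * g ^ 3 * k₁ * k₂ + (2:ℝ) * Y ^ 4 * k₂ ^ 2 + (-5:ℝ) * Y ^ 4 * g * k₂ ^ 2 + (-1:ℝ) * Y ^ 4 * g ^ 2 * k₂ ^ 2 + (-1:ℝ) * Y ^ 4 * z * g * k₂ ^ 2 + (1:ℝ) * Y ^ 4 * z * g ^ 2 * k₂ ^ 2) := by rw [key]; positivity
  rw [← conv] at hsum
  by_contra hc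
  have h1 : (k₂ - k₁) ^ 1 * qkFD Y z g lam (Y * k₂) k₁ k₂ < 0 := mul_neg_of_pos_of_neg (pow_pos hd0 1) (not_le.1 hc)
  have hμ : (0:ℝ) < (((3185:ℝ)/5756) * Y + ((2571:ℝ)/5756) * (1 - Y)) := by nlinarith [hY0, hY1, h1z, hg0]
  have h2 : (((3185:ℝ)/5756) * Y + ((2571:ℝ)/5756) * (1 - Y)) * ((k₂ - k₁) ^ 1 * qkFD Y z g lam (Y * k₂) k₁ k₂) < 0 := mul_neg_of_pos_of_neg hμ h1
  linarith

end LawDec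

end Quant

end Summit.CriticalPhenomena.PercolationContinuityZ3.Theorems
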